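import Mathlib
import HarnessLib
import Summits.Ventures.LatticeQCDFlow.Scaling.TorusClosingSection

/-!
# LatticeQCDFlow / Scaling — NO FREE CLOSING: along every compatible generation order of an optimal
# structure, the last link of every uncovered plaquette is the top link of a covered one

HONEST FRAMING: exact (Metropolis-corrected) sampling algorithms for lattice gauge theory;
figures of merit are autocorrelation/cost numbers at stated couplings and volumes; no
continuum-physics claim.

Venture `LatticeQCDFlow` (cell pub-lqcd), topic `Scaling`, FANOUT row 30 (lean-1, GEN-26) — OUR WORK on
THEORY-2.md §4 row C5, the order-level form of `TorusClosingSection.exists_topLink_mem_of_optimal`.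
An exact one-plaquette heat-bath autoregression of `(ℤ/L)^d` runs along a duplicate-free list of all links
in which every covered plaquette `p ∈ B` has its top link `t p` AFTER its three other links
(`PlaquetteTopLinkOrders.exists_order_of_topLink_rank`): at `t p` the link is drawn from the heat bath of
`p`, at every other link from Haar.  An UNCOVERED plaquette `p'` closes at its last link; if that link were
a free (Haar) draw, `p'` could be adjoined to `B` with it as top link — so for an OPTIMAL structure
(`#Bᶜ = k_min(d, L)`, `TorusRankedMorseCount`) this never happens:

* **`lastLink_eq_topLink_of_optimal`** — `L ≥ 2`, `(B, t, rank)` ranked with `#Bᶜ = k_min(d, L)`, `l` a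
  list of all links compatible with `t`; then for every `p' ∉ B` the `l`-last link of `p'` is
  `t p` for some covered `p ∈ B` (and `t p` lies on `p'`): EVERY UNCOVERED PLAQUETTE IS CLOSED BY A
  HEAT-BATH DRAW MADE FOR ANOTHER PLAQUETTE — the moment at which the exact sampler's proposal and the
  target part ways, and the mechanism behind the two-plaquette constant `M₂` of the volume law
  (`PlaquetteSharedLinkPeeling`, `AutoregressiveGaugeHeatBathVolumeLaw`).

No `def`, no `sorry`, nothing cited as a fact.
-/

namespace Summit.Ventures.LatticeQCDFlow.Theory2.Autoregressive

open Finset Function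
open Literature.MathematicalPhysics.QuantumFieldTheory Literature.MathematicalPhysics.QuantumLattice

variable {d L : ℕ} [NeZero L]

/-- **NO FREE CLOSING.**  `L ≥ 2`; `(B, t, rank)` ranked with `#Bᶜ = k_min(d, L) = (d−1)(d−2)/2·L^d + (d−1)`;
`l` a list of all links along which every covered plaquette's top link comes after its
other links.  Then for every uncovered plaquette `p'` there is a covered `p ∈ B` whose top link `t p` lies
on `p'` and comes last among the four links of `p'` in `l`.  (Otherwise the `l`-last link `e` of `p'` is no
top link, and `B ∪ {p'}` with `t p' = e`, ranked by the position of the top link in `l`, beats `k_min`.)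
[ours] -/
theorem lastLink_eq_topLink_of_optimal (hL : 2 ≤ L) (B : Finset (Plaquette d L))
    (t : Plaquette d L → Edge d L)
    (ht : ∀ p ∈ B, t p ∈ ({(p.1, p.2.1.1), (p.1.shift p.2.1.1, p.2.1.2),
        (p.1.shift p.2.1.2, p.2.1.1), (p.1, p.2.1.2)} : Finset (Edge d L)))
    (rank : Plaquette d L → ℕ)
    (hrank : ∀ p ∈ B, ∀ p' ∈ B, p ≠ p' → t p ∈ ({(p'.1, p'.2.1.1), (p'.1.shift p'.2.1.1, p'.2.1.2),
        (p'.1.shift p'.2.1.2, p'.2.1.1), (p'.1, p'.2.1.2)} : Finset (Edge d L)) → rank p < rank p')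
    (hopt : (Finset.univ \ B).card = (d - 1) * (d - 2) / 2 * L ^ d + (d - 1))
    (l : List (Edge d L)) (hall : ∀ e : Edge d L, e ∈ l)
    (hcompat : ∀ p ∈ B, ∀ e' ∈ ({(p.1, p.2.1.1), (p.1.shift p.2.1.1, p.2.1.2),
        (p.1.shift p.2.1.2, p.2.1.1), (p.1, p.2.1.2)} : Finset (Edge d L)), e' ≠ t p →
        l.idxOf e' < l.idxOf (t p))
    {p' : Plaquette d L} (hp' : p' ∉ B) :
    ∃ p ∈ B, t p ∈ ({(p'.1, p'.2.1.1), (p'.1.shift p'.2.1.1, p'.2.1.2),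
        (p'.1.shift p'.2.1.2, p'.2.1.1), (p'.1, p'.2.1.2)} : Finset (Edge d L)) ∧
      ∀ e' ∈ ({(p'.1, p'.2.1.1), (p'.1.shift p'.2.1.1, p'.2.1.2),
        (p'.1.shift p'.2.1.2, p'.2.1.1), (p'.1, p'.2.1.2)} : Finset (Edge d L)), l.idxOf e' ≤ l.idxOf (t p) := by
  classical
  -- the `l`-last link `e` of `p'`
  obtain ⟨e, he, hemax⟩ := Finset.exists_max_image ({(p'.1, p'.2.1.1), (p'.1.shift p'.2.1.1, p'.2.1.2),
    (p'.1.shift p'.2.1.2, p'.2.1.1), (p'.1, p'.2.1.2)} : Finset (Edge d L)) (fun e => l.idxOf e)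
    ⟨(p'.1, p'.2.1.1), by simp⟩
  by_cases hex : ∃ p ∈ B, t p = e
  · obtain ⟨p, hp, hpe⟩ := hex
    exact ⟨p, hp, hpe ▸ he, fun e' he' => hpe ▸ hemax e' he'⟩
  · -- `e` is no top link: adjoin `p'` with top link `e`, ranked by the position of the top link in `l`
    exfalso
    push Not at hex
    set B' : Finset (Plaquette d L) := insert p' B with hB'
    set t' : Plaquette d L → Edge d L := Function.update t p' e with ht'def
    set rank' : Plaquette d L → ℕ := fun p => l.idxOf (t' p) with hrank'def
    have hne_of_mem : ∀ p ∈ B, p ≠ p' := fun p hp h => hp' (h ▸ hp)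
    have ht'p' : t' p' = e := by simp [ht'def]
    have ht'B : ∀ p ∈ B, t' p = t p := fun p hp => by rw [ht'def, Function.update_of_ne (hne_of_mem p hp)]
    have ht' : ∀ p ∈ B', t' p ∈ ({(p.1, p.2.1.1), (p.1.shift p.2.1.1, p.2.1.2),
        (p.1.shift p.2.1.2, p.2.1.1), (p.1, p.2.1.2)} : Finset (Edge d L)) := by
      intro p hp
      rcases Finset.mem_insert.1 hp with rfl | hpB
      · rw [ht'p']; exact he
      · rw [ht'B p hpB]; exact ht p hpB
    -- strict inequality of positions for distinct links of `l`
    have hidx_lt : ∀ {a b : Edge d L}, a ≠ b → l.idxOf a ≤ l.idxOf b → l.idxOf a < l.idxOf b := by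
      intro a b hab hle
      refine lt_of_le_of_ne hle fun h => hab ?_
      exact (List.idxOf_inj (hall a)).1 h
    have hrank' : ∀ p ∈ B', ∀ q ∈ B', p ≠ q → t' p ∈ ({(q.1, q.2.1.1), (q.1.shift q.2.1.1, q.2.1.2),
        (q.1.shift q.2.1.2, q.2.1.1), (q.1, q.2.1.2)} : Finset (Edge d L)) → rank' p < rank' q := by
      intro p hp q hq hne hmem
      simp only [hrank'def]
      rcases Finset.mem_insert.1 hq with rfl | hqB
      · -- `q = p'`: `t' p = t p` lies on `p'`, and `e` is the last link of `p'`, different from `t p`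
        rcases Finset.mem_insert.1 hp with rfl | hpB
        · exact absurd rfl hne
        · rw [ht'B p hpB] at hmem ⊢
          rw [ht'p']
          exact hidx_lt (hex p hpB) (hemax _ hmem)
      · -- `q ∈ B`: `t' q = t q` comes after every other link of `q`
        rw [ht'B q hqB]
        have hneq : t' p ≠ t q := by
          rcases Finset.mem_insert.1 hp with rfl | hpB
          · rw [ht'p']; exact fun h => hex q hqB h.symm
          · rw [ht'B p hpB]
            intro h
            exact hne (injOn_of_ranked B t ht rank hrank hpB hqB h)
        exact hcompat q hqB (t' p) hmem hneq
    have hbound := homologyBound_closed_form hL B' t' ht' rank' hrank'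
    have hmem' : p' ∈ Finset.univ \ B := Finset.mem_sdiff.2 ⟨Finset.mem_univ _, hp'⟩
    have hsd : Finset.univ \ B' = (Finset.univ \ B).erase p' := by
      ext q
      simp only [hB', Finset.mem_sdiff, Finset.mem_univ, true_and, Finset.mem_insert, not_or,
        Finset.mem_erase]
    have hcard : (Finset.univ \ B').card + 1 = (Finset.univ \ B).card := by
      rw [hsd, Finset.card_erase_of_mem hmem']
      have : 0 < (Finset.univ \ B).card := Finset.card_pos.2 ⟨p', hmem'⟩
      omega
    have hE := two_mul_choose_coeff d
    have h3 : (d - 1) * (d - 2) * L ^ d = 2 * ((d - 1) * (d - 2) / 2 * L ^ d) := by rw [← mul_assoc, hE]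
    omega

end Summit.Ventures.LatticeQCDFlow.Theory2.Autoregressive
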